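import Summits.ValiantsHypothesis.ValiantsHypothesis.Theorems.DepthWindowTopBracketDefs
import HarnessLib

/-!
# Route `DepthWindow` — top bracket of the product-depth dial, part 3/5: the invariant of the levels

Decomp-valiant workshop, lens 4, generation 48 (cell O32).  Route-independent, definition-free.  For ANY
one-level expansion scheme `S : Scheme H` (part 1 §2) the levelled circuit of part 1 §3 satisfies the
Valiant–Skyum–Berkowitz–Rackoff invariant `gateValues_gatesUpTo`: the level-`j` value gate of every atom of
formal degree `≤ S.B ^ j` holds the value of the atom (level `0`: affine gates; level `j + 1`: the `≤ S.W`
product gates of an atom evaluate its terms from the level-`j` values, the value gate sums them, or copies the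
level-`j` gate when the formal degree is `≤ 1`).  With the index and reference bookkeeping
(`length_gatesUpTo`, `refs_prodLayer`, `refs_sumLayer`).  This is the tree's `VSBRProductDepth.lean` (scheme
`(expandAtom, #ι², 5, 2)`) re-proved verbatim with the parameters `W, F, B`.  Nothing here bears on
`VP ≠ VNP`; 0 sorry.

References: [ValiantSkyumBerkowitzRackoff1983]; [Burgisser2000TCS] Thm. 2.5; [Tavenas2015] §4 Def. 4, §5 Prop. 3;
[AgrawalVinay2008]; [LimayeSrinivasanTavenas2025] §1 (product depth).
-/

-- layout Summits/ValiantsHypothesis/ValiantsHypothesis forces the duplicated namespace component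
set_option linter.dupNamespace false

noncomputable section

open MvPolynomial Literature.Computability.AlgebraicComplexity
open Literature.Computability.AlgebraicComplexity.DepthReduction ArithCircuit
open Literature.Computability.AlgebraicComplexity.DepthReduction.HomCircuit (Atom termWidth)

namespace Summit.ValiantsHypothesis.ValiantsHypothesis.Theorems.DepthWindow

namespace TopBracket

universe u v w

variable {k : Type u} {σ : Type v} {ι : Type w} [CommSemiring k]

/-! ### Level `0`: one affine gate per atom -/

section LevelZero

variable (H : HomCircuit k σ ι) [DecidableEq ι] [Fintype ι] [Fintype σ] [DecidableEq σ]

/-- Level `0` has one gate per atom. [folklore] -/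
theorem length_levelZero : (levelZero H).length = Fintype.card (Atom ι) := by
  simp [levelZero]

omit [DecidableEq ι] [Fintype ι] in
/-- The operands of an affine gate are the constant `1` and variables. [folklore] -/
theorem affineGate_refsBelow (q : MvPolynomial σ k) (n : ℕ) :
    ∀ u ∈ (affineGate q).args, u.RefsBelow n := by
  intro u hu
  simp only [affineGate, Gate.args, List.map_cons, List.map_map, List.mem_cons, List.mem_map,
    Function.comp] at hu
  rcases hu with rfl | ⟨x, -, rfl⟩ <;> trivial

/-- Level `0` refers to no gate. [folklore] -/
theorem refs_levelZero :
    ∀ g ∈ levelZero (σ := σ) H, ∀ u ∈ g.args, u.RefsBelow ([] : List (Gate k σ)).length := by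
  intro g hg u hu
  simp only [levelZero, List.mem_map] at hg
  obtain ⟨m, -, rfl⟩ := hg
  exact affineGate_refsBelow _ _ u hu

end LevelZero

namespace Scheme

variable {H : HomCircuit k σ ι} [DecidableEq ι] [Fintype ι] (S : Scheme H)

/-! ### Indexing the levels: level `j` holds one value gate per atom, at index `vIdx j a` -/

/-- `vIdx j a < plen j`. [folklore] -/
theorem vIdx_lt_plen (j : ℕ) (a : Atom ι) : S.vIdx j a < S.plen j :=
  Nat.add_lt_add_left (Fintype.equivFin (Atom ι) a).isLt _

/-- `plen (j + 1) = plen j + #atoms·W + #atoms`. [folklore] -/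
theorem plen_succ (j : ℕ) :
    S.plen (j + 1) = S.plen j + Fintype.card (Atom ι) * S.W + Fintype.card (Atom ι) := by
  simp only [plen, vbase, blockLen]; ring

/-- `vbase (j + 1) = plen j + #atoms·W`. [folklore] -/
theorem vbase_succ (j : ℕ) : S.vbase (j + 1) = S.plen j + Fintype.card (Atom ι) * S.W := by
  simp only [plen, vbase, blockLen]; ring

/-! ### The gates of one level -/

/-- The product layer has `#atoms · W` gates. [folklore] -/
theorem length_prodLayer (j : ℕ) : (S.prodLayer j).length = Fintype.card (Atom ι) * S.W := by
  simp [prodLayer]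

/-- The value layer has one gate per atom. [folklore] -/
theorem length_sumLayer (j : ℕ) : (S.sumLayer j).length = Fintype.card (Atom ι) := by
  simp [sumLayer]

/-- A product gate has fan-in `≤ F`. [folklore] -/
theorem fanIn_prodGate_le (j : ℕ) (a : Atom ι) (r : Fin S.W) : (S.prodGate j a r).fanIn ≤ S.F := by
  unfold prodGate
  split_ifs with h
  · simp only [Gate.fanIn, Gate.args, List.length_map]
    exact S.tlength_le a _ (List.getElem_mem h)
  · simp [Gate.fanIn, Gate.args]

/-- A value gate has fan-in `≤ W + 1`. [folklore] -/
theorem fanIn_sumGate_le (j : ℕ) (a : Atom ι) : (S.sumGate j a).fanIn ≤ S.W + 1 := by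
  unfold sumGate
  split_ifs <;> simp [Gate.fanIn, Gate.args]

/-! ### Values of one level -/

/-- Sum over `Fin W` of the entries of a list padded with `0`. [folklore] -/
theorem sum_getD_zero {M : Type*} [AddCommMonoid M] : ∀ (l : List M) (W : ℕ), l.length ≤ W →
    ∑ π : Fin W, l.getD π.val 0 = l.sum := by
  intro l
  induction l with
  | nil => intro W _; simp
  | cons a l ih =>
    intro W hW
    obtain ⟨W, rfl⟩ : ∃ W', W = W' + 1 := ⟨W - 1, by simp at hW; omega⟩
    rw [Fin.sum_univ_succ]
    simp only [Fin.val_zero, List.getD_cons_zero, Fin.val_succ, List.getD_cons_succ,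
      List.sum_cons]
    rw [ih W (by simp at hW; omega)]

omit [Fintype ι] in
/-- From the degree clause: an atom of a term of an atom of formal degree `≤ B^(j+1)` has formal degree
`≤ B^j`. [folklore] -/
theorem adeg_le_of_mem {j : ℕ} {a b : Atom ι} {T : List (Atom ι)} (hT : T ∈ S.E a) (hb : b ∈ T)
    (ha : H.adeg a ≤ S.B ^ (j + 1)) : H.adeg b ≤ S.B ^ j := by
  rcases S.deg_le a T hT b hb with h | h
  · exact h.trans (Nat.one_le_pow _ _ S.B_pos)
  · rw [pow_succ'] at ha
    exact Nat.le_of_mul_le_mul_left (h.trans ha) S.B_pos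

/-- A product gate of level `j + 1` of an atom of formal degree `≤ B^(j+1)` computes the value of its
term, given correct level-`j` values of all atoms of formal degree `≤ B^j`.
[cite: ValiantSkyumBerkowitzRackoff1983] -/
theorem eval_prodGate (j : ℕ) (vals : List (MvPolynomial σ k))
    (hvals : ∀ b : Atom ι, H.adeg b ≤ S.B ^ j → vals[S.vIdx j b]? = some (H.aval b))
    {a : Atom ι} (ha : H.adeg a ≤ S.B ^ (j + 1)) (r : Fin S.W) :
    (S.prodGate j a r).eval vals = ((S.E a).map H.tval).getD r.val 0 := by
  unfold prodGate
  rw [List.getD_eq_getElem?_getD, List.getElem?_map]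
  split_ifs with h
  · rw [List.getElem?_eq_getElem h]
    simp only [Gate.eval, List.map_map, Option.map_some, Option.getD_some, HomCircuit.tval]
    congr 1
    apply List.map_congr_left
    intro b hb
    have hT : (S.E a)[r.val] ∈ S.E a := List.getElem_mem h
    have hb2 : H.adeg b ≤ S.B ^ j := S.adeg_le_of_mem hT hb ha
    simp only [Function.comp, Operand.eval, List.getD_eq_getElem?_getD, hvals b hb2,
      Option.getD_some]
  · rw [List.getElem?_eq_none (by omega)]
    simp [Gate.eval]

/-- A value gate of level `j + 1` of an atom of formal degree `≤ B^(j+1)` computes the value of the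
atom, given correct level-`j` values followed by the values of the product layer.
[cite: ValiantSkyumBerkowitzRackoff1983] -/
theorem eval_sumGate (j : ℕ) (vals : List (MvPolynomial σ k)) (hlen : vals.length = S.plen j)
    (hvals : ∀ b : Atom ι, H.adeg b ≤ S.B ^ j → vals[S.vIdx j b]? = some (H.aval b))
    {a : Atom ι} (ha : H.adeg a ≤ S.B ^ (j + 1)) :
    (S.sumGate j a).eval (vals ++ (S.prodLayer j).map fun g => g.eval vals) = H.aval a := by
  generalize hp : (S.prodLayer j).map (fun g => g.eval vals) = pvals
  unfold sumGate
  split_ifs with h2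
  · have hle : ((S.E a).map H.tval).length ≤ S.W := by
      rw [List.length_map]; exact S.length_le a
    simp only [Gate.eval, List.map_map]
    rw [← S.sum_eq a h2, ← sum_getD_zero _ _ hle, Fin.sum_univ_def]
    congr 1
    apply List.map_congr_left
    intro r _
    simp only [Function.comp, Operand.eval_gate, List.getD_eq_getElem?_getD, one_smul]
    rw [List.getElem?_append_right (by rw [hlen]; omega), hlen, Nat.add_sub_cancel_left,
      ← hp, List.getElem?_map, prodLayer, List.getElem?_map,
      List.getElem?_eq_getElem (by rw [List.length_finRange]; exact (finProdFinEquiv _).isLt)]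
    simp only [List.getElem_finRange, Fin.cast_mk, Option.map_some, Option.getD_some, Fin.eta,
      Equiv.symm_apply_apply]
    rw [S.eval_prodGate j vals hvals ha, List.getD_eq_getElem?_getD]
  · have ha1 : H.adeg a ≤ S.B ^ j := (show H.adeg a ≤ 1 by omega).trans (Nat.one_le_pow _ _ S.B_pos)
    simp only [Gate.eval, List.map_cons, List.map_nil, List.sum_cons, List.sum_nil, add_zero,
      Operand.eval_gate, List.getD_eq_getElem?_getD, one_smul]
    rw [List.getElem?_append_left (by rw [hlen]; exact S.vIdx_lt_plen j a), hvals a ha1,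
      Option.getD_some]

/-! ### All levels -/

variable [Fintype σ] [DecidableEq σ]

/-- The levels `0, …, j` have `plen j` gates. [folklore] -/
theorem length_gatesUpTo : ∀ j : ℕ, (S.gatesUpTo j).length = S.plen j
  | 0 => by simp [gatesUpTo, length_levelZero, plen, vbase]
  | j + 1 => by
    rw [gatesUpTo, List.length_append, List.length_append, length_gatesUpTo j,
      length_prodLayer, length_sumLayer, plen_succ]

/-- The product layer of level `j + 1` refers only to the levels `≤ j`. [folklore] -/
theorem refs_prodLayer (j : ℕ) :
    ∀ g ∈ S.prodLayer j, ∀ u ∈ g.args, u.RefsBelow (S.gatesUpTo j).length := by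
  intro g hg u hu
  simp only [prodLayer, List.mem_map] at hg
  obtain ⟨q, -, rfl⟩ := hg
  unfold prodGate at hu
  split_ifs at hu with h
  · simp only [Gate.args, List.mem_map] at hu
    obtain ⟨b, -, rfl⟩ := hu
    simp only [Operand.RefsBelow, length_gatesUpTo]
    exact S.vIdx_lt_plen j b
  · simp [Gate.args] at hu

/-- The value layer of level `j + 1` refers only to the levels `≤ j` and its product layer. [folklore] -/
theorem refs_sumLayer (j : ℕ) :
    ∀ g ∈ S.sumLayer j, ∀ u ∈ g.args, u.RefsBelow (S.gatesUpTo j ++ S.prodLayer j).length := by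
  intro g hg u hu
  simp only [sumLayer, List.mem_map] at hg
  obtain ⟨m, -, rfl⟩ := hg
  unfold sumGate at hu
  rw [List.length_append, length_gatesUpTo, length_prodLayer]
  split_ifs at hu with h
  · simp only [Gate.args, List.map_map, List.mem_map, Function.comp] at hu
    obtain ⟨r, -, rfl⟩ := hu
    simp only [Operand.RefsBelow]
    have := (finProdFinEquiv (Fintype.equivFin (Atom ι) ((Fintype.equivFin (Atom ι)).symm m), r)).isLt
    omega
  · simp only [Gate.args, List.map_cons, List.map_nil, List.mem_singleton] at hu
    subst hu
    simp only [Operand.RefsBelow]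
    have := S.vIdx_lt_plen j ((Fintype.equivFin (Atom ι)).symm m : Atom ι)
    omega

/-- **The invariant of the levels**: the value gate of level `j` of every atom of formal degree
`≤ B^j` holds the value of the atom. [cite: ValiantSkyumBerkowitzRackoff1983] [cite: Burgisser2000TCS, Thm. 2.5] -/
theorem gateValues_gatesUpTo : ∀ (j : ℕ) (a : Atom ι), H.adeg a ≤ S.B ^ j →
    (gateValues (S.gatesUpTo j))[S.vIdx j a]? = some (H.aval a)
  | 0, a, ha => by
    have h0 := gateValues_layer (k := k) (σ := σ) [] (levelZero H) (refs_levelZero H)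
    simp only [List.nil_append] at h0
    rw [gatesUpTo, h0]
    simp only [gateValues, List.foldl_nil, List.nil_append, vIdx, vbase, zero_mul, zero_add,
      levelZero, List.map_map, List.getElem?_map]
    rw [List.getElem?_eq_getElem (by rw [List.length_finRange]; exact (Fintype.equivFin (Atom ι) a).isLt)]
    simp only [List.getElem_finRange, Fin.cast_mk, Option.map_some, Fin.eta, Function.comp,
      Equiv.symm_apply_apply]
    rw [eval_affineGate _ ((H.totalDegree_aval_le a).trans (by simpa using ha))]
  | j + 1, a, ha => by
    have ih := gateValues_gatesUpTo j
    have hlenj : (gateValues (S.gatesUpTo j)).length = S.plen j := by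
      rw [gateValues_length, length_gatesUpTo]
    rw [gatesUpTo, gateValues_layer _ _ (S.refs_sumLayer j),
      gateValues_layer _ _ (S.refs_prodLayer j)]
    have hlen : (gateValues (S.gatesUpTo j) ++
        (S.prodLayer j).map fun g => g.eval (gateValues (S.gatesUpTo j))).length =
        S.vbase (j + 1) := by
      rw [List.length_append, List.length_map, hlenj, length_prodLayer, vbase_succ]
    rw [vIdx, List.getElem?_append_right (by rw [hlen]; exact Nat.le_add_right _ _), hlen,
      Nat.add_sub_cancel_left, List.getElem?_map, sumLayer, List.getElem?_map,
      List.getElem?_eq_getElem (by rw [List.length_finRange]; exact (Fintype.equivFin (Atom ι) a).isLt)]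
    simp only [List.getElem_finRange, Fin.cast_mk, Option.map_some, Fin.eta,
      Equiv.symm_apply_apply]
    rw [S.eval_sumGate j _ hlenj ih ha]

end Scheme

end TopBracket

end Summit.ValiantsHypothesis.ValiantsHypothesis.Theorems.DepthWindow

end
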